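import Literature.MathematicalPhysics.KineticTheory.LangevinChainDegenerateHormander
import Literature.Analysis.Distribution.BracketGeneratingLift
import HarnessLib

/-!
# CEHR Prop. 4.1 (chain, degenerate coupling) without the bare drift, and the bracket condition for `L* - ∂_t`

Topic `Literature/MathematicalPhysics/KineticTheory`. Cuneo–Eckmann–Hairer–Rey-Bellet 2018, Prop. 3.2
("the transition probabilities have a density `p_t(z, z')` … smooth", from Hörmander's theorem for
the PARABOLIC operator) needs the bracket condition of `L* - ∂_t` on `ℝ × Ω`, whose fields are the
lifts `X̃_b = (0, X_b)`, `X̃₀ = (-1, X₀)` of the Fokker–Planck family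
`OscillatorChain.hormanderFamily = (X₀ = -Y, X_L, X_R)` (`LangevinChainHormander.lean`). By the
generic lift `Literature.Analysis.Distribution.isBracketGenerating_lift` (`BracketGeneratingLift.lean`)
this follows from the bracket condition of `(X₀, X_L, X_R)` on `Ω` established WITHOUT the bare word
`X₀`, which is what the printed sweep of Prop. 4.1 does (it starts from `∂_{p_b}` and only ever
brackets). This file re-runs the degenerate-coupling sweep of `LangevinChainDegenerateHormander.lean`
(RB-non-degenerate coupling `RBNondegenerate P.V`, e.g. `V = r⁴/4`) inside the restricted germ
module `InGermModuleMod` (allowed bare words: the noise fields), exactly as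
`ReyBelletThomas2002HormanderLift.lean` does for the Rey-Bellet–Thomas model:

* `OscillatorChain.bracketSpanModAt_hormanderFamily_eq_top` — Prop. 4.1 without the bare drift for
  the Fokker–Planck family `(-Y, X_L, X_R)`;
* `OscillatorChain.generatorFamily`, `bracketSpanModAt_generatorFamily_eq_top` — the same for the
  generator's family `(Y, X_L, X_R)` (sign flip: rescaling invariance of the restricted span);
* `OscillatorChain.langevinParabolicFamily`, **`isBracketGenerating_langevinParabolicFamily`** —
  the family `(X̃₀, X̃_L, X̃_R)` of `L* - ∂_t` on `ℝ × Ω` and its bracket condition everywhere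
  (smooth potentials, `RBNondegenerate P.V`, `γT_L > 0`, `N ≥ 1`).

## References

* N. Cuneo, J.-P. Eckmann, M. Hairer, L. Rey-Bellet, EJP 23 (2018) no. 55 (arXiv:1712.09413):
  Prop. 3.2, Prop. 4.1 and its proof (arXiv p. 10: `M₀ = {∂_t - X₀} ∪ {X_{b,i}}`).
* L. Hörmander, Acta Math. 119 (1967) 147–171, Thm 1.1.
-/

noncomputable section

open Set Filter VectorField Finset MeasureTheory Literature.Analysis.Distribution
open scoped ContDiff Topology

namespace Literature.MathematicalPhysics.KineticTheory.HeatConduction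

variable {N : ℕ}

namespace OscillatorChain

variable (P : OscillatorChain)

/-! ### The sweep of Prop. 4.1 in the restricted germ module -/

section Brackets

variable {P} (hN : 0 < N) {T_L T_R : ℝ} (hU : ContDiff ℝ ∞ P.U) (hV : ContDiff ℝ ∞ P.V)
  {A : Set (Option (Fin 2))} (hA : ∀ b : Fin 2, some b ∈ A)
include hU hV

omit hU hV in
include hA in
/-- `∂_{p_0}` is in the restricted germ module (indeed in `lieSpanMod`): `X_L = √(γT_L) ∂_{p_0}`,
`γT_L > 0`, and `X_L` is an allowed bare word. [cite: CuneoEckmannHairerReyBellet2018, Prop 4.1] -/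
theorem inGermModuleMod_unitP_left (hγL : 0 < P.γ * T_L) (x₀ : PhaseSpace N) :
    InGermModuleMod (P.hormanderFamily hN T_L T_R) A x₀ (fun _ => unitP ⟨0, hN⟩) := by
  have hs : Real.sqrt (P.γ * T_L) ≠ 0 := Real.sqrt_ne_zero'.2 hγL
  have h : InGermModuleMod (P.hormanderFamily hN T_L T_R) A x₀
      ((Real.sqrt (P.γ * T_L))⁻¹ • P.hormanderFamily hN T_L T_R (some 0)) :=
    (InGermModuleMod.mem (mem_lieSpanMod_of (hA 0))).const_smul _
  have e : ((Real.sqrt (P.γ * T_L))⁻¹ • P.hormanderFamily hN T_L T_R (some 0)) =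
      fun _ => (unitP ⟨0, hN⟩ : PhaseSpace N) := by
    funext y
    simp [hormanderFamily, bathField, bathSite, bathTemp, smul_smul, inv_mul_cancel₀ hs]
  rwa [e] at h

/-- The bracket of a constant field `v` in the restricted germ module with `X₀ = -Y` (a bracket,
not a bare word) puts `y ↦ DY(y)·v` in the restricted germ module. [folklore] -/
theorem inGermModuleMod_fderiv_drift {x₀ v : PhaseSpace N}
    (hv : InGermModuleMod (P.hormanderFamily hN T_L T_R) A x₀ (fun _ => v)) :
    InGermModuleMod (P.hormanderFamily hN T_L T_R) A x₀ fun y => fderiv ℝ (P.drift N) y v := by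
  have h := hv.lieBracket_family_right (P.hormanderFamily_smooth hU hV hN T_L T_R) none
  rw [show P.hormanderFamily hN T_L T_R none = P.adjointDrift N from rfl,
    lieBracket_const_left] at h
  have e : (fun y => fderiv ℝ (P.adjointDrift N) y v) =
      -(fun y => fderiv ℝ (P.drift N) y v) := by
    funext y
    have : P.adjointDrift N = fun y => -P.drift N y := rfl
    rw [this, fderiv_fun_neg]
    rfl
  rw [e] at h
  simpa using h.neg

/-- **Momentum ⇒ position** in the restricted germ module: if `∂_{p_i}` is in it then so is
`∂_{q_i}` (`DY·∂_{p_i} = ∂_{q_i} - γ 1_B(i) ∂_{p_i}`). [cite: CuneoEckmannHairerReyBellet2018, Prop 4.1] -/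
theorem inGermModuleMod_unitQ_of_unitP {x₀ : PhaseSpace N} {i : Fin N}
    (hi : InGermModuleMod (P.hormanderFamily hN T_L T_R) A x₀ (fun _ => unitP i)) :
    InGermModuleMod (P.hormanderFamily hN T_L T_R) A x₀ (fun _ => unitQ i) := by
  have h := P.inGermModuleMod_fderiv_drift hN hU hV hi
  simp only [P.fderiv_drift_unitP_eq hU hV] at h
  have h' := h.sub (hi.const_smul (-(P.γ * bathWeight N i)))
  have e : ((fun _ : PhaseSpace N => (unitQ i : PhaseSpace N) +
      (-(P.γ * bathWeight N i)) • (unitP i : PhaseSpace N)) -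
      (-(P.γ * bathWeight N i)) • (fun _ : PhaseSpace N => (unitP i : PhaseSpace N))) =
      fun _ => unitQ i := by
    funext y
    simp only [Pi.sub_apply, Pi.smul_apply]
    abel
  rwa [e] at h'

/-- **The Hessian column modulo known directions**, restricted germ module: if `∂_{q_{i'}}` and all
`∂_{p_l}`, `l ≤ i'`, are in it and `i = i' + 1`, then so is `y ↦ V''(q_i - q_{i'}) ∂_{p_i}`.
[cite: CuneoEckmannHairerReyBellet2018, Prop 4.1] -/
theorem inGermModuleMod_hess_smul_unitP {x₀ : PhaseSpace N} {i i' : Fin N}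
    (hii' : i.val = i'.val + 1)
    (hQ : InGermModuleMod (P.hormanderFamily hN T_L T_R) A x₀ (fun _ => unitQ i'))
    (hPl : ∀ l : Fin N, l.val ≤ i'.val →
      InGermModuleMod (P.hormanderFamily hN T_L T_R) A x₀ (fun _ => unitP l)) :
    InGermModuleMod (P.hormanderFamily hN T_L T_R) A x₀
      (fun y => deriv (deriv P.V) (y.1 i - y.1 i') • (unitP i : PhaseSpace N)) := by
  have h := P.inGermModuleMod_fderiv_drift hN hU hV hQ
  simp only [P.fderiv_drift_unitQ_eq hU hV] at h
  have hsum : (fun y : PhaseSpace N =>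
      ∑ l : Fin N, (-P.hessPotential N l i' y.1) • (unitP l : PhaseSpace N)) =
      ∑ l : Fin N, fun y => (-P.hessPotential N l i' y.1) • (unitP l : PhaseSpace N) := by
    funext y
    rw [Finset.sum_apply]
  rw [hsum, ← Finset.add_sum_erase _ _ (Finset.mem_univ i)] at h
  have hrest : InGermModuleMod (P.hormanderFamily hN T_L T_R) A x₀
      (∑ l ∈ Finset.univ.erase i,
        fun y => (-P.hessPotential N l i' y.1) • (unitP l : PhaseSpace N)) := by
    refine InGermModuleMod.finset_sum _ fun l hl => ?_
    have hli : l ≠ i := Finset.ne_of_mem_erase hl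
    rcases Nat.lt_or_ge l.val i.val with hlt | hge
    · -- `l ≤ i'`: known direction, smooth coefficient
      have hsm : ContDiff ℝ ∞ fun y : PhaseSpace N => -P.hessPotential N l i' y.1 := by
        have hc : ContDiff ℝ ∞ fun y : PhaseSpace N => fderiv ℝ (P.drift N) y (unitQ i') :=
          ((P.contDiff_drift hU hV N).fderiv_right (m := ∞) (by exact_mod_cast le_top)).clm_apply
            contDiff_const
        have : (fun y : PhaseSpace N => -P.hessPotential N l i' y.1) =
            fun y => ((fderiv ℝ (P.drift N) y (unitQ i')).2) l := by
          funext y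
          rw [P.fderiv_drift_apply hU hV]
          simp [unitQ, Pi.single_apply]
        rw [this]
        exact (contDiff_apply ℝ ℝ l).comp (contDiff_snd.comp hc)
      exact (hPl l (by omega)).smul (Eventually.of_forall fun y => hsm.contDiffAt)
    · -- `l ≥ i + 1 = i' + 2`: the Hessian entry vanishes identically
      have hl2 : i'.val + 2 ≤ l.val := by
        have : l.val ≠ i.val := fun e => hli (Fin.ext e)
        omega
      have : (fun y : PhaseSpace N =>
          (-P.hessPotential N l i' y.1) • (unitP l : PhaseSpace N)) = 0 := by
        funext y
        rw [P.hessPotential_eq_zero_of_le N hl2, neg_zero, zero_smul]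
        rfl
      rw [this]
      exact InGermModuleMod.zero
  have hmain := h.sub hrest
  rw [add_sub_cancel_right] at hmain
  have e : (fun y : PhaseSpace N =>
      (-P.hessPotential N i i' y.1) • (unitP i : PhaseSpace N)) =
      fun y => deriv (deriv P.V) (y.1 i - y.1 i') • (unitP i : PhaseSpace N) := by
    funext y
    rw [P.hessPotential_succ N hii', neg_neg]
  rwa [e] at hmain

/-- All `Z_k = (-1)^k V⁽ᵏ⁾(q_i - q_{i'}) ∂_{p_i}`, `k ≥ 2`, are in the restricted germ module once
`Z_2` and `∂_{q_{i'}}` are (`[∂_{q_{i'}}, Z_k] = Z_{k+1}` is a bracket).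
[cite: CuneoEckmannHairerReyBellet2018, Prop 4.1] -/
theorem inGermModuleMod_couplingDerivCoeff_smul {x₀ : PhaseSpace N} {i i' : Fin N} (hii' : i ≠ i')
    (hQ : InGermModuleMod (P.hormanderFamily hN T_L T_R) A x₀ (fun _ => unitQ i'))
    (h2 : InGermModuleMod (P.hormanderFamily hN T_L T_R) A x₀
      (fun y => ((-1 : ℝ) ^ 2 * iteratedDeriv 2 P.V (y.1 i - y.1 i')) • (unitP i : PhaseSpace N)))
    (k : ℕ) (hk : 2 ≤ k) :
    InGermModuleMod (P.hormanderFamily hN T_L T_R) A x₀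
      (fun y => ((-1 : ℝ) ^ k * iteratedDeriv k P.V (y.1 i - y.1 i')) • (unitP i : PhaseSpace N)) := by
  induction k with
  | zero => omega
  | succ k ih =>
    rcases Nat.lt_or_ge k 2 with hlt | hge
    · have : k + 1 = 2 := by omega
      rw [this]; exact h2
    · rw [← P.lieBracket_unitQ_couplingDerivCoeff_smul hV k hii']
      exact hQ.lieBracket (P.hormanderFamily_smooth hU hV hN T_L T_R) (ih hge)

/-- **The non-degeneracy step** in the restricted germ module: from `∂_{q_{i'}}`, the `∂_{p_l}`
(`l ≤ i'`) and `RBNondegenerate P.V` at `q_i - q_{i'}` (`i = i' + 1`), the direction `∂_{p_i}` is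
in the restricted germ module at `x₀`. [cite: CuneoEckmannHairerReyBellet2018, Prop 4.1] -/
theorem inGermModuleMod_unitP_succ (hV2 : RBNondegenerate P.V) {x₀ : PhaseSpace N}
    {i i' : Fin N} (hii' : i.val = i'.val + 1)
    (hQ : InGermModuleMod (P.hormanderFamily hN T_L T_R) A x₀ (fun _ => unitQ i'))
    (hPl : ∀ l : Fin N, l.val ≤ i'.val →
      InGermModuleMod (P.hormanderFamily hN T_L T_R) A x₀ (fun _ => unitP l)) :
    InGermModuleMod (P.hormanderFamily hN T_L T_R) A x₀ (fun _ => unitP i) := by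
  have hne : i ≠ i' := fun e => by rw [e] at hii'; omega
  -- `Z_2`
  have h2 : InGermModuleMod (P.hormanderFamily hN T_L T_R) A x₀
      (fun y => ((-1 : ℝ) ^ 2 * iteratedDeriv 2 P.V (y.1 i - y.1 i')) • (unitP i : PhaseSpace N)) := by
    have h := P.inGermModuleMod_hess_smul_unitP hN hU hV hii' hQ hPl
    have e : (fun y : PhaseSpace N =>
        ((-1 : ℝ) ^ 2 * iteratedDeriv 2 P.V (y.1 i - y.1 i')) • (unitP i : PhaseSpace N)) =
        fun y => deriv (deriv P.V) (y.1 i - y.1 i') • (unitP i : PhaseSpace N) := by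
      funext y
      simp [iteratedDeriv_succ, iteratedDeriv_zero]
    rwa [e]
  -- non-degeneracy at the bond
  obtain ⟨m, hm, hm0⟩ := hV2 (x₀.1 i - x₀.1 i')
  have hZ := P.inGermModuleMod_couplingDerivCoeff_smul hN hU hV hne hQ h2 m hm
  refine InGermModuleMod.of_smul_of_ne_zero
    (Eventually.of_forall fun y => (P.contDiff_couplingDerivCoeff hV m i i').contDiffAt) ?_ hZ
  exact mul_ne_zero (pow_ne_zero _ (by norm_num)) hm0

include hA in
/-- **CEHR Prop. 4.1 (chain, degenerate coupling) without the bare drift word**: for smooth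
potentials with `RBNondegenerate P.V` and a genuine left bath (`γT_L > 0`), the values at every
point of the brackets of LENGTH `≥ 2` of the Fokker–Planck family `(-Y, X_L, X_R)` together with
the noise fields `X_L, X_R` already span phase space — the bare word `X₀ = -Y` is never needed
(the printed sweep starts from `∂_{p_b}` and only ever brackets). This is the input of the lift to
the parabolic operator `L* - ∂_t` (`isBracketGenerating_lift`).
[cite: CuneoEckmannHairerReyBellet2018, Prop 4.1] -/
theorem bracketSpanModAt_hormanderFamily_eq_top (hV2 : RBNondegenerate P.V) (hγL : 0 < P.γ * T_L)
    (x₀ : PhaseSpace N) :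
    bracketSpanModAt (P.hormanderFamily hN T_L T_R) A x₀ = ⊤ := by
  -- every coordinate direction is in the restricted germ module at `x₀`, by strong induction
  have key : ∀ m : ℕ, ∀ i : Fin N, i.val = m →
      InGermModuleMod (P.hormanderFamily hN T_L T_R) A x₀ (fun _ => unitP i) ∧
        InGermModuleMod (P.hormanderFamily hN T_L T_R) A x₀ (fun _ => unitQ i) := by
    intro m
    induction m using Nat.strong_induction_on with
    | _ m ih =>
      intro i him
      have hPi : InGermModuleMod (P.hormanderFamily hN T_L T_R) A x₀ (fun _ => unitP i) := by
        rcases Nat.eq_zero_or_pos m with hm | hm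
        · have : i = ⟨0, hN⟩ := Fin.ext (by rw [him, hm])
          rw [this]
          exact P.inGermModuleMod_unitP_left hN hA hγL x₀
        · set i' : Fin N := ⟨m - 1, by omega⟩ with hi'
          have hii' : i.val = i'.val + 1 := by simp [hi']; omega
          refine P.inGermModuleMod_unitP_succ hN hU hV hV2 hii' (ih i'.val (by simp [hi']; omega) i' rfl).2
            fun l hl => (ih l.val (by simp [hi'] at hl; omega) l rfl).1
      exact ⟨hPi, P.inGermModuleMod_unitQ_of_unitP hN hU hV hPi⟩
  refine bracketSpanModAt_eq_top_of_inGermModuleMod (span_unitQ_unitP_eq_top N) ?_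
  rintro v (⟨i, rfl⟩ | ⟨i, rfl⟩)
  · exact (key _ i rfl).2
  · exact (key _ i rfl).1

end Brackets

/-! ### The generator's own family `(Y, X_L, X_R)` -/

/-- The family `(X₀ = Y, X_L, X_R)` of the GENERATOR `L = X_L² + X_R² + Y` (the drift with its own
sign; the backward variable of the joint density). [cite: CuneoEckmannHairerReyBellet2018, §3 eq. (3.2)] -/
def generatorFamily (hN : 0 < N) (T_L T_R : ℝ) : Option (Fin 2) → PhaseSpace N → PhaseSpace N :=
  fun o => o.elim (P.drift N) (P.bathField hN T_L T_R)

/-- The generator's family is the Fokker–Planck family with the drift's sign flipped. [folklore] -/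
theorem generatorFamily_eq_smul (hN : 0 < N) (T_L T_R : ℝ) (o : Option (Fin 2)) :
    P.generatorFamily hN T_L T_R o =
      (Option.elim o (-1 : ℝ) fun _ => 1) • P.hormanderFamily hN T_L T_R o := by
  cases o with
  | none =>
    funext y
    simp [generatorFamily, hormanderFamily, adjointDrift]
  | some b =>
    funext y
    simp [generatorFamily, hormanderFamily]

/-- All fields of the generator's family are smooth. [folklore] -/
theorem contDiff_generatorFamily (hU : ContDiff ℝ ∞ P.U) (hV : ContDiff ℝ ∞ P.V) (hN : 0 < N)
    (T_L T_R : ℝ) (o : Option (Fin 2)) : ContDiff ℝ ∞ (P.generatorFamily hN T_L T_R o) := by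
  rw [P.generatorFamily_eq_smul hN T_L T_R o]
  exact (P.hormanderFamily_smooth hU hV hN T_L T_R o).const_smul (Option.elim o (-1 : ℝ) fun _ => 1)

/-- **Prop. 4.1 without the bare drift, for the generator's family `(Y, X_L, X_R)`** (sign flip of
the drift: rescaling invariance of the restricted span). [cite: CuneoEckmannHairerReyBellet2018, Prop 4.1] -/
theorem bracketSpanModAt_generatorFamily_eq_top (hN : 0 < N) {T_L T_R : ℝ} (hU : ContDiff ℝ ∞ P.U)
    (hV : ContDiff ℝ ∞ P.V) {A : Set (Option (Fin 2))} (hA : ∀ b : Fin 2, some b ∈ A)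
    (hV2 : RBNondegenerate P.V) (hγL : 0 < P.γ * T_L) (x₀ : PhaseSpace N) :
    bracketSpanModAt (P.generatorFamily hN T_L T_R) A x₀ = ⊤ := by
  rw [bracketSpanModAt_eq_of_eq_smul (P.hormanderFamily_smooth hU hV hN T_L T_R)
    (P.generatorFamily_eq_smul hN T_L T_R) (fun o => by cases o <;> simp) x₀]
  exact P.bracketSpanModAt_hormanderFamily_eq_top hN hU hV hA hV2 hγL x₀

/-! ### The family of `L* - ∂_t` on `ℝ × Ω` and its bracket condition -/

/-- The time components of the lifted fields: `-1` on the drift, `0` on the noise fields.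
[folklore] -/
def langevinTimeCoeff (o : Option (Fin 2)) : ℝ := Option.elim o (-1) fun _ => 0

/-- **The family `(X̃₀, X̃_L, X̃_R)` of the parabolic operator `L* - ∂_t = X̃_L² + X̃_R² + X̃₀ + 2γ`
on `ℝ × Ω`**: `X̃₀ = (-1, -Y)`, `X̃_b = (0, X_b)` (lifts of the Fokker–Planck family).
[cite: CuneoEckmannHairerReyBellet2018, Prop 3.2] -/
def langevinParabolicFamily (hN : 0 < N) (T_L T_R : ℝ) :
    Option (Fin 2) → ℝ × PhaseSpace N → ℝ × PhaseSpace N :=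
  fun o => liftField (langevinTimeCoeff o) (P.hormanderFamily hN T_L T_R o)

/-- The parabolic family in Hörmander's `Option.elim` form. [folklore] -/
theorem langevinParabolicFamily_eq_elim (hN : 0 < N) (T_L T_R : ℝ) :
    P.langevinParabolicFamily hN T_L T_R = fun o => o.elim
      (liftField (-1) (P.adjointDrift N)) (fun b => liftField 0 (P.bathField hN T_L T_R b)) := by
  funext o
  cases o <;> rfl

/-- The drift of the parabolic family: `X̃₀(t, y) = (-1, -Y(y))`. [folklore] -/
@[simp] theorem langevinParabolicFamily_none (hN : 0 < N) (T_L T_R : ℝ) (p : ℝ × PhaseSpace N) :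
    P.langevinParabolicFamily hN T_L T_R none p = (-1, P.adjointDrift N p.2) := rfl

/-- The noise fields of the parabolic family: `X̃_b(t, y) = (0, X_b)`. [folklore] -/
@[simp] theorem langevinParabolicFamily_some (hN : 0 < N) (T_L T_R : ℝ) (b : Fin 2)
    (p : ℝ × PhaseSpace N) :
    P.langevinParabolicFamily hN T_L T_R (some b) p = (0, P.bathField hN T_L T_R b p.2) := rfl

/-- All fields of the parabolic family are smooth (smooth potentials). [folklore] -/
theorem contDiff_langevinParabolicFamily (hU : ContDiff ℝ ∞ P.U) (hV : ContDiff ℝ ∞ P.V) (hN : 0 < N)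
    (T_L T_R : ℝ) (o : Option (Fin 2)) : ContDiff ℝ ∞ (P.langevinParabolicFamily hN T_L T_R o) :=
  contDiff_liftField _ (P.hormanderFamily_smooth hU hV hN T_L T_R o)

/-- **The bracket condition for the parabolic operator `L* - ∂_t` of the Langevin chain, everywhere
on `ℝ × Ω`**, for smooth potentials with `RBNondegenerate P.V`, `γT_L > 0`, `N ≥ 1`: from Prop. 4.1
without the bare drift and the generic lift (brackets kill the constant time components; `X̃₀`
supplies the time direction). [cite: CuneoEckmannHairerReyBellet2018, Prop 3.2 and Prop 4.1] -/
theorem isBracketGenerating_langevinParabolicFamily (hU : ContDiff ℝ ∞ P.U) (hV : ContDiff ℝ ∞ P.V)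
    (hN : 0 < N) {T_L T_R : ℝ} (hV2 : RBNondegenerate P.V) (hγL : 0 < P.γ * T_L) :
    IsBracketGenerating (P.langevinParabolicFamily hN T_L T_R) univ := by
  have hX := P.hormanderFamily_smooth hU hV hN T_L T_R
  have hA : ∀ b : Fin 2, some b ∈ {o : Option (Fin 2) | langevinTimeCoeff o = 0} := fun b => by
    simp [langevinTimeCoeff]
  have h := isBracketGenerating_lift langevinTimeCoeff hX (s := univ)
    (fun y _ => P.bracketSpanModAt_hormanderFamily_eq_top hN hU hV hA hV2 hγL y)
    (i₀ := none) (by simp [langevinTimeCoeff])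
  rwa [univ_prod_univ] at h

end OscillatorChain

end Literature.MathematicalPhysics.KineticTheory.HeatConduction
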